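import Summits.Ventures.CertifiedArithmetic.LowPrec.DoubleRoundingGmidBelow
import Summits.Ventures.CertifiedArithmetic.LowPrec.DoubleRoundingDivisionMatrix

/-!
# The precision strips are never innocuous — products and quotients, for every pair of records

HONEST FRAMING: certified error envelopes and provably optimal rounding/accumulation schemes for
low-precision formats under stated cost models; every table by two implementations; no hardware
or vendor claims.

The innocuous-embedding theorems decide double rounding `fl_φ ∘ fl_ψ = fl_φ` of products and
quotients of data of `φ` POSITIVELY from `P_ψ ≥ 2P_φ` (`DoubleRoundingProduct.lean` (ii),
`DoubleRoundingDivision.lean` clause (Q)), and the `13 × 13` matrices of named records show the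
clause attained on named cells (`DoubleRoundingProductCells.lean`,
`DoubleRoundingDivisionMatrix.lean`).  This file proves the converse for EVERY pair of format
RECORDS `φ ⊆ ψ` — `quantum ψ ∣ quantum φ` (`hq`), the finite range of `φ` inside that of
`ψ` (`hM`), both biases `≥ 1`, and `4` a value of `φ` (`2^(m+bias+1) ≤ maxScaled`) —:
throughout the PRECISION STRIP `P_φ < P_ψ ≤ 2P_φ - 1`, i.e. `m_φ < m_ψ ≤ 2m_φ`,

* (×, `P_φ ≥ 4`) `not_drMul_strip`: some product of two data of `φ` is double rounded
  wrongly — the square of `a = 3/2 - 2^(1-P)` (`P ≥ 5`; `a = 13/8` at `P = 4`):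
  `a² = μ + 2^(2-2P)` with `μ` the midpoint above an EVEN value of `φ` in `[2, 4)`; for
  `P_ψ ≤ 2P - 2` the offset is below half the spacing `2^(2-P_ψ)` of `ψ` there
  (`DoubleRoundingProductStrip`), and AT `P_ψ = 2P - 1` it is exactly half of it and the tie
  of `ψ` resolves to the even datum `μ` (`DoubleRoundingGmidBelow.roundNE_roundNE_ne_gmid_tie`);
* (÷, `P_φ ≥ 2`) `not_drDiv_strip`: `4 / (2 - 2^(1-P)) = 2 + 2^(1-P) + δ` with
  `0 < δ = 2^(1-P)/(2^P - 1) < 2^(1-P_ψ)`, just above the midpoint `2 + 2^(1-P)` of `φ`.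

So, record-generically, the thresholds `2P` of the product and quotient clauses are attained:
the strips are never innocuous ([Figueroa1995] §3 and [Roux2014] Remark 30 give one witness at
one precision; [Rump2016] Lemma 4.4 the binary64/binary32 instance).  The hypothesis `P_φ ≥ 4`
of the product law is sharp in the pure-precision model: implementation A
(`certs/enum/DOUBLE-ROUNDING-MUL.json`, all significand pairs) finds the strips of `P = 2, 3`
innocuous and, at `P_ψ = 2P - 1`, the square above as the ONLY failing pair for `P = 4 … 8`.
Square root, whose strip is one column wider, is `DoubleRoundingSqrtStrip.lean`.
-/

namespace Summit.Ventures.CertifiedArithmetic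

open Literature.ComputerArithmetic.FloatingPoint
open Literature.ComputerArithmetic.FloatingPoint.Format
open Literature.ComputerArithmetic.FloatingPoint.MiniFloat

/-! ## §1 Units and the bookkeeping of an embedding -/

/-- `2^(m + bias - 1)` quanta is the value `1`. [folklore] -/
theorem two_pow_mul_quantum_eq_one {φ : Format} (hb : 1 ≤ φ.bias) :
    (2 : ℚ) ^ (φ.manBits + (φ.bias - 1)) * φ.quantum = 1 := by
  unfold Format.quantum Format.qexp
  rw [← zpow_natCast, ← zpow_add₀ (by norm_num : (2 : ℚ) ≠ 0)]
  have h : ((φ.manBits + (φ.bias - 1) : ℕ) : ℤ) + (1 - (φ.bias : ℤ) - φ.manBits) = 0 := by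
    omega
  rw [h, zpow_zero]

/-- The quantum as a fraction: `quantum = 1 / 2^(m + bias - 1)`. [folklore] -/
theorem quantum_eq_one_div {φ : Format} {k : ℕ} (hk : φ.bias = k + 1) :
    φ.quantum = 1 / (2 ^ φ.manBits * 2 ^ k) := by
  have h := two_pow_mul_quantum_eq_one (φ := φ) (by omega)
  rw [hk, Nat.add_sub_cancel, pow_add] at h
  rw [eq_div_iff (by positivity)]
  linarith

/-- Bookkeeping of `φ ⊆ ψ`: with `d = qexp φ - qexp ψ ≥ 0`,
`m_φ + bias_φ + d = m_ψ + bias_ψ`. [folklore] -/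
theorem manBits_add_bias_add_toNat {φ ψ : Format} (hq : ψ.qexp ≤ φ.qexp) :
    φ.manBits + φ.bias + (φ.qexp - ψ.qexp).toNat = ψ.manBits + ψ.bias := by
  have h := Int.toNat_of_nonneg (sub_nonneg.mpr hq)
  have e1 : φ.qexp = 1 - (φ.bias : ℤ) - φ.manBits := rfl
  have e2 : ψ.qexp = 1 - (ψ.bias : ℤ) - ψ.manBits := rfl
  omega

/-! ## §2 Products: the square witness -/

/-- PRODUCTS SLIP THROUGHOUT THE STRIP, generic square witness: if `s² = (2t+1)·2^m + 1` with
`t` even, `2^m ≤ t < 2^(m+1)`, `s < 2^(m+1)` (`m = m_φ ≥ 2`), then for every `ψ ⊇ φ` with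
`m_φ < m_ψ ≤ 2m_φ` the datum `a = s·2^(bias-1)` quanta (value `s/2^m ∈ [1,2)`) has
`fl_φ (fl_ψ (a·a)) ≠ fl_φ (a·a)`: `a² = μ + 2^(-2m)` with `μ = (2t+1)·2^(bias-1)` quanta,
the midpoint above the even value `t·2^bias` quanta; `2 · 2^(-2m)` is below the spacing
`2^(1-m_ψ)` of `ψ` at `μ ∈ [2,4)` when `m_ψ < 2m`, equal to it when `m_ψ = 2m`. -/
theorem not_drMul_of_sq_witness {φ ψ : Format} (hq : ψ.qexp ≤ φ.qexp)
    (hM : φ.maxScaled * 2 ^ (φ.qexp - ψ.qexp).toNat ≤ ψ.maxScaled) (h2 : 2 ≤ φ.manBits)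
    (hP : φ.manBits < ψ.manBits) (hP2 : ψ.manBits ≤ 2 * φ.manBits) (hb : 1 ≤ φ.bias)
    (hb' : 1 ≤ ψ.bias) (hR : 2 ^ (φ.manBits + φ.bias + 1) ≤ φ.maxScaled) {s t : ℕ}
    (hs : s * s = (2 * t + 1) * 2 ^ φ.manBits + 1) (hs1 : s < 2 ^ (φ.manBits + 1))
    (ht : Even t) (htlo : 2 ^ φ.manBits ≤ t) (hthi : t < 2 ^ (φ.manBits + 1)) :
    ¬ ∀ a b : MiniFloat φ, (roundNE φ (roundNE ψ (a.toRat * b.toRat)).toRat).toRat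
      = (roundNE φ (a.toRat * b.toRat)).toRat := by
  obtain ⟨k, hk⟩ : ∃ k, φ.bias = k + 1 := ⟨φ.bias - 1, by omega⟩
  obtain ⟨k', hk2⟩ : ∃ k', ψ.bias = k' + 1 := ⟨ψ.bias - 1, by omega⟩
  have hqφ := φ.quantum_pos
  have hqψ := ψ.quantum_pos
  have hunit : (2 : ℚ) ^ (φ.manBits + k) * φ.quantum = 1 := by
    have h := two_pow_mul_quantum_eq_one hb; rwa [hk, Nat.add_sub_cancel] at h
  have hQ := quantum_eq_one_div hk
  have hQ' := quantum_eq_one_div hk2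
  have hdB := manBits_add_bias_add_toNat hq
  -- the datum `a = s · 2^k` quanta and the range side conditions
  have hR' : 2 ^ (φ.manBits + 1) * 2 ^ (k + 1) ≤ φ.maxScaled := by
    rw [← pow_add, show φ.manBits + 1 + (k + 1) = φ.manBits + φ.bias + 1 by omega]; exact hR
  have hsk : s * 2 ^ k ≤ φ.maxScaled := by
    refine le_trans (Nat.mul_le_mul hs1.le (Nat.pow_le_pow_right (by norm_num) (Nat.le_succ k)))
      hR'
  obtain ⟨a, ha⟩ := exists_toRat_eq_natMul (representable_mul_pow hs1 hsk)
  have hu : (t + 1) * 2 ^ (k + 1) ≤ φ.maxScaled :=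
    le_trans (Nat.mul_le_mul_right _ (by omega)) hR'
  have hk' : ψ.manBits ≤ φ.manBits + k + (φ.qexp - ψ.qexp).toNat := by omega
  have hx : φ.manBits + k + (φ.qexp - ψ.qexp).toNat + 1 - ψ.manBits = k' + 1 := by omega
  -- the product: `a² = μ + δ`, `δ = (2^k · quantum)² = 2^(-2m)`
  set δ : ℚ := (2 ^ k * φ.quantum) ^ 2 with hδ
  have hδ0 : 0 < δ := by positivity
  have hs' : (s : ℚ) * s = (2 * t + 1) * 2 ^ φ.manBits + 1 := by exact_mod_cast hs
  have hab : a.toRat * a.toRat = (((2 * t + 1) * 2 ^ k : ℕ) : ℚ) * φ.quantum + δ := by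
    rw [ha, hδ]; push_cast
    linear_combination ((2 : ℚ) ^ k * φ.quantum) ^ 2 * hs'
      + (2 * (t : ℚ) + 1) * 2 ^ k * φ.quantum * hunit
  -- `δ = 1/2^(2m)` and the spacing of `ψ` at `μ` is `2 · 2^k' · quantum ψ = 2/2^(m_ψ)`
  have hδval : δ = 1 / (2 ^ φ.manBits) ^ 2 := by
    rw [hδ, hQ]; field_simp
  have hsp : (2 : ℚ) ^ (k' + 1) * ψ.quantum = 2 / 2 ^ ψ.manBits := by
    rw [hQ']; field_simp; ring
  rcases eq_or_lt_of_le hP2 with heq | hlt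
  · -- the tie column `m_ψ = 2 m_φ`
    have hδψ : 2 * δ
        = 2 ^ (φ.manBits + k + (φ.qexp - ψ.qexp).toNat + 1 - ψ.manBits) * ψ.quantum := by
      rw [hx, hsp, hδval, heq, pow_mul']; ring
    intro h
    have h' := h a a
    rw [hab] at h'
    exact roundNE_roundNE_ne_gmid_tie hq hM (by omega) (by omega) ht htlo hthi hu hk' hδψ h'
  · -- the strict columns `m_ψ < 2 m_φ`
    have hpow : (2 : ℚ) ^ ψ.manBits < (2 ^ φ.manBits) ^ 2 := by
      rw [← pow_mul]; exact pow_lt_pow_right₀ (by norm_num) (by omega)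
    have hδψ : 2 * δ
        < 2 ^ (φ.manBits + k + (φ.qexp - ψ.qexp).toNat + 1 - ψ.manBits) * ψ.quantum := by
      rw [hx, hsp, hδval, ← div_eq_mul_one_div]
      exact div_lt_div_of_pos_left (by norm_num) (by positivity) hpow
    exact not_drMul_of_gmid_witness hq hM (by omega) hP ht htlo hthi hu hk' hδ0 hδψ a a hab

/-- PRODUCTS: THE PRECISION STRIP IS NEVER INNOCUOUS — for every pair of format records
`φ ⊆ ψ` (grid and range of `φ` inside those of `ψ`, biases `≥ 1`, `4` a value of `φ`) with
`P_φ ≥ 4` and `P_φ < P_ψ ≤ 2P_φ - 1`, some product of two data of `φ` is double rounded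
wrongly through `ψ`: the square of `3/2 - 2^(1-P)` (`P ≥ 5`), of `13/8` (`P = 4`).  With
`DoubleRoundingProduct` (ii) (`P_ψ ≥ 2P_φ` innocuous) the threshold `2P` is attained for every
record, not only on the named matrix (`DoubleRoundingProductCells`).
[cite: Figueroa1995, §3; Rump2016, Lemma 4.4] -/
theorem not_drMul_strip {φ ψ : Format} (hq : ψ.qexp ≤ φ.qexp)
    (hM : φ.maxScaled * 2 ^ (φ.qexp - ψ.qexp).toNat ≤ ψ.maxScaled) (h3 : 3 ≤ φ.manBits)
    (hP : φ.manBits < ψ.manBits) (hP2 : ψ.manBits ≤ 2 * φ.manBits) (hb : 1 ≤ φ.bias)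
    (hb' : 1 ≤ ψ.bias) (hR : 2 ^ (φ.manBits + φ.bias + 1) ≤ φ.maxScaled) :
    ¬ ∀ a b : MiniFloat φ, (roundNE φ (roundNE ψ (a.toRat * b.toRat)).toRat).toRat
      = (roundNE φ (a.toRat * b.toRat)).toRat := by
  rcases eq_or_lt_of_le h3 with h3 | h4
  · -- `P = 4`: `13² = 21 · 8 + 1`, `t = 10`
    have h8 : 2 ^ φ.manBits = 8 := by rw [← h3]; rfl
    refine not_drMul_of_sq_witness hq hM (by omega) hP hP2 hb hb' hR (s := 13) (t := 10)
      (by rw [h8]) (by rw [pow_succ, h8]; norm_num) ⟨5, rfl⟩ (by rw [h8]; norm_num)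
      (by rw [pow_succ, h8]; norm_num)
  · -- `P ≥ 5`: `s = 3·2^(m-1) - 1 = 24w + 23`, `t = 9·2^(m-3) - 2 = 18w + 16`,
    -- `2^(m-4) = w + 1`
    obtain ⟨j, hj⟩ := Nat.exists_eq_add_of_le h4
    obtain ⟨w, hw⟩ := Nat.exists_eq_add_of_le' (Nat.one_le_two_pow (n := j))
    have h16 : 2 ^ φ.manBits = 16 * (w + 1) := by rw [hj, pow_add, hw]; ring
    refine not_drMul_of_sq_witness hq hM (by omega) hP hP2 hb hb' hR (s := 24 * w + 23)
      (t := 18 * w + 16) (by rw [h16]; ring) (by rw [pow_succ, h16]; omega) ⟨9 * w + 8, by ring⟩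
      (by rw [h16]; omega) (by rw [pow_succ, h16]; omega)

/-! ## §3 Quotients: `4 / (2 - 2^(1-P))` -/

/-- QUOTIENTS: THE PRECISION STRIP IS NEVER INNOCUOUS — for every pair of format records
`φ ⊆ ψ` as above with `P_φ ≥ 2` and `P_φ < P_ψ ≤ 2P_φ - 1`, `¬ DRDiv φ ψ`: the
quotient `4 / (2 - 2^(1-P)) = (2 + 2^(1-P)) + 2^(1-P)/(2^P - 1)` of two data of `φ` lies
above the midpoint `2 + 2^(1-P)` of `φ` (above the EVEN value `2`) by less than half the spacing
`2^(2-P_ψ)` of `ψ` there (`2^(P_ψ - P) < 2^P - 1`), so `fl_ψ` returns the midpoint and `fl_φ`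
then `2`, while `fl_φ` of the quotient is `2 + 2^(2-P)`.  With `DoubleRoundingDivision`'s
clause (Q) (`P_ψ ≥ 2P_φ`) the threshold `2P` is attained for every record.
[cite: Figueroa1995, §3; Roux2014, Remark 30] -/
theorem not_drDiv_strip {φ ψ : Format} (hq : ψ.qexp ≤ φ.qexp)
    (hM : φ.maxScaled * 2 ^ (φ.qexp - ψ.qexp).toNat ≤ ψ.maxScaled) (h1 : 1 ≤ φ.manBits)
    (hP : φ.manBits < ψ.manBits) (hP2 : ψ.manBits ≤ 2 * φ.manBits) (hb : 1 ≤ φ.bias)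
    (hb' : 1 ≤ ψ.bias) (hR : 2 ^ (φ.manBits + φ.bias + 1) ≤ φ.maxScaled) :
    ¬ DRDiv φ ψ := by
  obtain ⟨k, hk⟩ : ∃ k, φ.bias = k + 1 := ⟨φ.bias - 1, by omega⟩
  obtain ⟨k', hk2⟩ : ∃ k', ψ.bias = k' + 1 := ⟨ψ.bias - 1, by omega⟩
  obtain ⟨M, hMm⟩ := Nat.exists_eq_add_of_le' (Nat.one_le_two_pow (n := φ.manBits))
  have hqφ := φ.quantum_pos
  have hqψ := ψ.quantum_pos
  have hMq : (2 : ℚ) ^ φ.manBits = M + 1 := by exact_mod_cast hMm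
  have hQ := quantum_eq_one_div hk
  have hQ' := quantum_eq_one_div hk2
  rw [hMq] at hQ
  have hdB := manBits_add_bias_add_toNat hq
  -- the data `a = 4 = (M+1)·2^(k+2)` quanta and `b = 2 - 2^-m = (2M+1)·2^k` quanta
  have hR' : (M + 1) * 2 ^ (k + 2) ≤ φ.maxScaled := by
    rw [← hMm, ← pow_add, show φ.manBits + (k + 2) = φ.manBits + φ.bias + 1 by omega]
    exact hR
  obtain ⟨a, ha⟩ := exists_toRat_eq_natMul
    (representable_mul_pow (φ := φ) (k := M + 1) (j := k + 2) (by rw [pow_succ]; omega) hR')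
  have hbR : (2 * M + 1) * 2 ^ k ≤ φ.maxScaled := by
    refine le_trans ?_ hR'
    rw [pow_add, mul_comm (2 ^ k) (2 ^ 2), ← mul_assoc]
    exact Nat.mul_le_mul_right _ (by have e : (2 : ℕ) ^ 2 = 4 := rfl; rw [e]; omega)
  obtain ⟨b, hb2⟩ := exists_toRat_eq_natMul
    (representable_mul_pow (φ := φ) (k := 2 * M + 1) (j := k) (by rw [pow_succ]; omega) hbR)
  -- the midpoint data: `t = 2^m = M + 1`, exponent `k = bias - 1`
  have ht : Even (M + 1) := by rw [← hMm]; exact (Nat.even_pow' (by omega)).mpr even_two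
  have hu : (M + 1 + 1) * 2 ^ (k + 1) ≤ φ.maxScaled := by
    refine le_trans ?_ hR'
    rw [pow_succ 2 (k + 1)]; nlinarith [Nat.one_le_two_pow (n := k + 1)]
  have hk' : ψ.manBits ≤ φ.manBits + k + (φ.qexp - ψ.qexp).toNat := by omega
  have hx : φ.manBits + k + (φ.qexp - ψ.qexp).toNat + 1 - ψ.manBits = k' + 1 := by omega
  -- the quotient: `a / b = μ + δ`, `δ = 1 / ((2M+1)(M+1)) = 2^-m / (2^(m+1) - 1)`
  set δ : ℚ := 1 / ((2 * M + 1) * (M + 1)) with hδ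
  have hδ0 : 0 < δ := by positivity
  have hb0 : b.toRat ≠ 0 := by rw [hb2]; positivity
  have hab : a.toRat / b.toRat = (((2 * (M + 1) + 1) * 2 ^ k : ℕ) : ℚ) * φ.quantum + δ := by
    rw [div_eq_iff hb0, ha, hb2, hδ, hQ]; push_cast; field_simp; ring
  have hsp : (2 : ℚ) ^ (k' + 1) * ψ.quantum = 2 / 2 ^ ψ.manBits := by
    rw [hQ']; field_simp; ring
  have hM1 : (1 : ℚ) ≤ M := by
    have h2 : 2 ≤ M + 1 := by
      rw [← hMm]; exact le_trans (by norm_num) (Nat.pow_le_pow_right (by norm_num) h1)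
    exact_mod_cast (by omega : 1 ≤ M)
  have hpow : (2 : ℚ) ^ ψ.manBits < (2 * M + 1) * (M + 1) := by
    calc (2 : ℚ) ^ ψ.manBits
        ≤ 2 ^ (φ.manBits * 2) := pow_le_pow_right₀ (by norm_num) (by omega)
      _ = (M + 1) * (M + 1) := by rw [pow_mul, hMq]; ring
      _ < (2 * M + 1) * (M + 1) := by nlinarith [hM1]
  have hδψ : 2 * δ
      < 2 ^ (φ.manBits + k + (φ.qexp - ψ.qexp).toNat + 1 - ψ.manBits) * ψ.quantum := by
    rw [hx, hsp, hδ, ← div_eq_mul_one_div]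
    exact div_lt_div_of_pos_left (by norm_num) (by positivity) hpow
  intro h
  have h' := h a b
  rw [hab] at h'
  exact roundNE_roundNE_ne_gmid hq hM h1 hP ht (le_of_eq hMm) (by rw [pow_succ]; omega) hu hk'
    hδ0 hδψ h'

/-! ## §4 Named instances (sanity; the cells are decided in the matrix files) -/

/-- e2m3 → binary8p5 (`P = 4 < 5 ≤ 7`): the square of `13/8`. -/
example : ¬ ∀ a b : MiniFloat E2M3,
    (roundNE E2M3 (roundNE Binary8p5 (a.toRat * b.toRat)).toRat).toRat
      = (roundNE E2M3 (a.toRat * b.toRat)).toRat :=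
  not_drMul_strip (by decide) (by decide +kernel) (by decide) (by decide) (by decide) (by decide)
    (by decide) (by decide +kernel)

/-- binary8p5 → bfloat16 (`P = 5 < 8 ≤ 9`): the square of `23/16`. -/
example : ¬ ∀ a b : MiniFloat Binary8p5,
    (roundNE Binary8p5 (roundNE BFloat16 (a.toRat * b.toRat)).toRat).toRat
      = (roundNE Binary8p5 (a.toRat * b.toRat)).toRat :=
  not_drMul_strip (by decide) (by decide +kernel) (by decide) (by decide) (by decide) (by decide)
    (by decide) (by decide +kernel)

/-- e2m1 → e5m2 (`P = 2 < 3 ≤ 3`): `4 / (3/2)`. -/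
example : ¬ DRDiv E2M1 E5M2 :=
  not_drDiv_strip (by decide) (by decide +kernel) (by decide) (by decide) (by decide) (by decide)
    (by decide) (by decide +kernel)

/-- e3m2 → e4m3 (`P = 3 < 4 ≤ 5`): `4 / (7/4)` (binary8p4 → binary16, `11 > 7`, is innocuous;
binary16 → bfloat16 is not an instance: fewer digits). -/
example : ¬ DRDiv E3M2 E4M3 :=
  not_drDiv_strip (by decide) (by decide +kernel) (by decide) (by decide) (by decide) (by decide)
    (by decide) (by decide +kernel)

end Summit.Ventures.CertifiedArithmetic
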